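import Summits.AtomisticToContinuum.Crystallization.Theorems.FreeSplittingCertificatesStrictSplittingRuleP1NearDefs
import Summits.AtomisticToContinuum.Crystallization.Theorems.FreeSplittingCertificatesStrictSplittingRuleSummableCorotated

/-!
# `StrictSplittingRule` (stmt-AtomisticToContinuum-12560): LEMMAS FOR THE NEAR REDUCTION — leg-load summability, the least-squares moment condition, the readout legs (G9; P1 interpolant object, part 59a)

Route `FreeSplittingCertificates`, crux r3 `StrictSplittingRule` (H12⋆ = `stub_coreJointCoercive`), unit b2b-freesplit-B gen 33.
VALUE = three bricks of the near reduction (part 59, `nearLedger_of_finite`):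
* `summable_legLoad_p1DispSite` — for the far-ledger field `V = p1DispSite a h U b₀ A` (Lipschitz) and weights with `Σ_e w_e|y_{q+s}−y_q|² < ∞`, the leg loads
  `e ↦ w_e·|V(q+s) − V q|²` are summable;
* `exists_linearMap_of_matrix`, `inner_apply_self_eq_zero_of_antisymm` — an antisymmetric coordinate matrix acts as a skew map;
* **`leastSquares_moment`** — the first-order optimality of the least-squares co-rotation `W` among skew maps: `Σ_{q∈SH}⟪u_q − u_p − W d_q, Z d_q⟫ = 0` for every
  antisymmetric `Z` (the constraint set of the near certificate);
* **`readoutForm_sub_farShares_le_p1NearRead`** — the readout-form series of `CoreJointSiteIneq` minus the two far-share series is at most the finite near readout term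
  `p1NearRead` (legs off `LEG` dropped by sign, the local column-sum term through `colβ`).
NOT a proof of H12⋆, NOT summit progress.  [folklore]
-/

noncomputable section

open Set Function Metric MeasureTheory Filter Topology
open scoped BigOperators NNReal ENNReal Classical

namespace Summit.AtomisticToContinuum.Crystallization.Theorems.StrictSplittingRuleBirth

open Literature.MathematicalPhysics.StatisticalMechanics
open Summit.AtomisticToContinuum.Crystallization.Theorems.PalmUnimodularRigidity.LayeredLawsSelectHcp
open Summit.AtomisticToContinuum.Crystallization.Theorems.PhononStabilityCWC.Cert (inner_fin3)

/-! ## Leg loads of the far-ledger field are summable against any weights with summable geometric loads -/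

/-- For `V = p1DispSite a h U b₀ A` (`U` finitely supported, hence `V` Lipschitz) and nonnegative leg weights `w` with `Σ_e w_e|y_{q+s} − y_q|² < ∞`:
the leg-load family `e ↦ w_e·|V(q+s) − V q|²` is summable.  NOT a proof of H12⋆, NOT summit progress. -/
theorem summable_legLoad_p1DispSite {a h : ℝ} (ha : 0 < a) (hh : 0 < h) (U : ℤ × ℤ × ℤ → (Fin 3 → ℝ))
    (hU : (support U).Finite) (b₀ : Fin 3 → ℝ) (A : Fin 3 → Fin 3 → ℝ)
    (w : (ℤ × ℤ × ℤ) × (ℤ × ℤ × ℤ) → ℝ) (hw : ∀ e, 0 ≤ w e)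
    (hws : Summable fun e : (ℤ × ℤ × ℤ) × (ℤ × ℤ × ℤ) => w e * fpSq (fun k => hcpSite a h (e.1 + e.2) k - hcpSite a h e.1 k)) :
    Summable fun e : (ℤ × ℤ × ℤ) × (ℤ × ℤ × ℤ) =>
      w e * fpSq (fun k => p1DispSite a h U b₀ A (e.1 + e.2) k - p1DispSite a h U b₀ A e.1 k) := by
  obtain ⟨K, hK⟩ := exists_lipschitzWith_p1Disp ha.ne' hh.ne' U hU b₀ A
  refine Summable.of_nonneg_of_le (fun e => mul_nonneg (hw e) (fpSq_nonneg _)) (fun e => ?_) (hws.mul_left (3 * (K : ℝ) ^ 2))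
  obtain ⟨q, s⟩ := e
  dsimp only
  set y1 : Fin 3 → ℝ := fun j => hcpSite a h (q + s) j with hy1
  set y2 : Fin 3 → ℝ := fun j => hcpSite a h q j with hy2
  have hF0 : 0 ≤ fpSq (fun k => hcpSite a h (q + s) k - hcpSite a h q k) := fpSq_nonneg _
  -- the sup distance of the two site coordinate vectors is at most the Euclidean one
  have hdist : dist y1 y2 ≤ Real.sqrt (fpSq (fun k => hcpSite a h (q + s) k - hcpSite a h q k)) := by
    rw [dist_eq_norm]
    refine (pi_norm_le_iff_of_nonneg (Real.sqrt_nonneg _)).2 fun j => ?_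
    rw [Real.norm_eq_abs]
    refine Real.abs_le_sqrt ?_
    have h0 := sq_nonneg (hcpSite a h (q + s) 0 - hcpSite a h q 0)
    have h1 := sq_nonneg (hcpSite a h (q + s) 1 - hcpSite a h q 1)
    have h2 := sq_nonneg (hcpSite a h (q + s) 2 - hcpSite a h q 2)
    simp only [hy1, hy2, Pi.sub_apply, fpSq]
    fin_cases j
    · show (hcpSite a h (q + s) 0 - hcpSite a h q 0) ^ 2 ≤ _
      linarith
    · show (hcpSite a h (q + s) 1 - hcpSite a h q 1) ^ 2 ≤ _
      linarith
    · show (hcpSite a h (q + s) 2 - hcpSite a h q 2) ^ 2 ≤ _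
      linarith
  have hdist2 : dist y1 y2 ^ 2 ≤ fpSq (fun k => hcpSite a h (q + s) k - hcpSite a h q k) := by
    calc dist y1 y2 ^ 2 ≤ Real.sqrt (fpSq (fun k => hcpSite a h (q + s) k - hcpSite a h q k)) ^ 2 :=
          pow_le_pow_left₀ dist_nonneg hdist 2
      _ = _ := Real.sq_sqrt hF0
  -- Lipschitz: each component of the value difference is at most K·dist
  have hV : ∀ k, |p1DispSite a h U b₀ A (q + s) k - p1DispSite a h U b₀ A q k| ≤ K * dist y1 y2 := by
    intro k
    have h2 : dist (p1Disp a h U b₀ A y1) (p1Disp a h U b₀ A y2) ≤ K * dist y1 y2 := hK.dist_le_mul _ _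
    have h3 := dist_le_pi_dist (p1Disp a h U b₀ A y1) (p1Disp a h U b₀ A y2) k
    rw [Real.dist_eq] at h3
    simp only [p1DispSite, PiLp.toLp_apply]
    exact h3.trans h2
  have hsq : ∀ k, (p1DispSite a h U b₀ A (q + s) k - p1DispSite a h U b₀ A q k) ^ 2 ≤
      (K : ℝ) ^ 2 * fpSq (fun k => hcpSite a h (q + s) k - hcpSite a h q k) := by
    intro k
    have h1 : (p1DispSite a h U b₀ A (q + s) k - p1DispSite a h U b₀ A q k) ^ 2 ≤ ((K : ℝ) * dist y1 y2) ^ 2 :=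
      sq_le_sq' (abs_le.1 (hV k)).1 (abs_le.1 (hV k)).2
    calc _ ≤ ((K : ℝ) * dist y1 y2) ^ 2 := h1
      _ = (K : ℝ) ^ 2 * dist y1 y2 ^ 2 := by ring
      _ ≤ (K : ℝ) ^ 2 * fpSq (fun k => hcpSite a h (q + s) k - hcpSite a h q k) := mul_le_mul_of_nonneg_left hdist2 (sq_nonneg _)
  have hR : fpSq (fun k => p1DispSite a h U b₀ A (q + s) k - p1DispSite a h U b₀ A q k) ≤
      3 * (K : ℝ) ^ 2 * fpSq (fun k => hcpSite a h (q + s) k - hcpSite a h q k) := by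
    have e : fpSq (fun k => p1DispSite a h U b₀ A (q + s) k - p1DispSite a h U b₀ A q k) =
        (p1DispSite a h U b₀ A (q + s) 0 - p1DispSite a h U b₀ A q 0) ^ 2 + (p1DispSite a h U b₀ A (q + s) 1 - p1DispSite a h U b₀ A q 1) ^ 2 +
          (p1DispSite a h U b₀ A (q + s) 2 - p1DispSite a h U b₀ A q 2) ^ 2 := rfl
    rw [e]
    linarith [hsq 0, hsq 1, hsq 2]
  calc w (q, s) * fpSq (fun k => p1DispSite a h U b₀ A (q + s) k - p1DispSite a h U b₀ A q k)
      ≤ w (q, s) * (3 * (K : ℝ) ^ 2 * fpSq (fun k => hcpSite a h (q + s) k - hcpSite a h q k)) := mul_le_mul_of_nonneg_left hR (hw _)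
    _ = 3 * (K : ℝ) ^ 2 * (w (q, s) * fpSq (fun k => hcpSite a h (q + s) k - hcpSite a h q k)) := by ring

/-! ## An antisymmetric coordinate matrix as a skew linear map -/

/-- The linear map `y ↦ (Σ_j y_j Z j k)_k` of a coordinate matrix `Z`. -/
theorem exists_linearMap_of_matrix (Z : Fin 3 → Fin 3 → ℝ) :
    ∃ Z' : EuclideanSpace ℝ (Fin 3) →ₗ[ℝ] EuclideanSpace ℝ (Fin 3), ∀ (y : EuclideanSpace ℝ (Fin 3)) (k : Fin 3),
      Z' y k = ∑ j : Fin 3, y j * Z j k := by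
  refine ⟨{ toFun := fun y => WithLp.toLp 2 (fun k => ∑ j : Fin 3, y j * Z j k)
            map_add' := fun y y' => ?_
            map_smul' := fun c y => ?_ }, fun y k => rfl⟩
  · ext k
    simp only [PiLp.add_apply, add_mul, Finset.sum_add_distrib]
  · ext k
    simp only [PiLp.smul_apply, smul_eq_mul, RingHom.id_apply, Finset.mul_sum, mul_assoc]

/-- An antisymmetric matrix acts as a skew map: `⟪Z' z, z⟫ = 0`. -/
theorem inner_apply_self_eq_zero_of_antisymm {Z : Fin 3 → Fin 3 → ℝ} (hZ : ∀ j k, Z j k = -Z k j)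
    {Z' : EuclideanSpace ℝ (Fin 3) →ₗ[ℝ] EuclideanSpace ℝ (Fin 3)}
    (hZ' : ∀ (y : EuclideanSpace ℝ (Fin 3)) (k : Fin 3), Z' y k = ∑ j : Fin 3, y j * Z j k) (z : EuclideanSpace ℝ (Fin 3)) :
    inner ℝ (Z' z) z = 0 := by
  have h00 : Z 0 0 = 0 := by have := hZ 0 0; linarith
  have h11 : Z 1 1 = 0 := by have := hZ 1 1; linarith
  have h22 : Z 2 2 = 0 := by have := hZ 2 2; linarith
  have h10 := hZ 1 0
  have h20 := hZ 2 0
  have h21 := hZ 2 1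
  rw [inner_fin3, hZ', hZ', hZ']
  simp only [Fin.sum_univ_three, h00, h11, h22, h10, h20, h21]
  ring

/-! ## The moment condition of the least-squares co-rotation -/

/-- **FIRST-ORDER OPTIMALITY OF THE LEAST-SQUARES CO-ROTATION**: if the skew `W` (matrix `A`) minimises `Σ_shell‖u_q − u_p − W' d_q‖²` among skew maps, then
`Σ_{q∈SH} Σ_k (u_q − u_p − W d_q)_k·(Z d_q)_k = 0` for every antisymmetric coordinate matrix `Z` (`SH` = the shell as a finset).  NOT a proof of H12⋆, NOT summit progress. -/
theorem leastSquares_moment {a h : ℝ} (u : ℤ × ℤ × ℤ → EuclideanSpace ℝ (Fin 3)) (p : ℤ × ℤ × ℤ)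
    (W : EuclideanSpace ℝ (Fin 3) →ₗ[ℝ] EuclideanSpace ℝ (Fin 3)) (hWskew : ∀ z : EuclideanSpace ℝ (Fin 3), inner ℝ (W z) z = 0)
    (hWLS : ∀ W' : EuclideanSpace ℝ (Fin 3) →ₗ[ℝ] EuclideanSpace ℝ (Fin 3), (∀ z : EuclideanSpace ℝ (Fin 3), inner ℝ (W' z) z = 0) →
        (∑' q : ℤ × ℤ × ℤ,
            (if 0 < ‖hcpSite a h q - hcpSite a h p‖ ∧ ‖hcpSite a h q - hcpSite a h p‖ ≤ 11 / 10 * a then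
              ‖u q - u p - W (hcpSite a h q - hcpSite a h p)‖ ^ 2 else (0 : ℝ))) ≤
        (∑' q : ℤ × ℤ × ℤ,
            (if 0 < ‖hcpSite a h q - hcpSite a h p‖ ∧ ‖hcpSite a h q - hcpSite a h p‖ ≤ 11 / 10 * a then
              ‖u q - u p - W' (hcpSite a h q - hcpSite a h p)‖ ^ 2 else (0 : ℝ))))
    (A : Fin 3 → Fin 3 → ℝ) (hA : ∀ (y : EuclideanSpace ℝ (Fin 3)) (k : Fin 3), W y k = y 0 * A 0 k + y 1 * A 1 k + y 2 * A 2 k)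
    (SH : Finset (ℤ × ℤ × ℤ))
    (hSH : ∀ q : ℤ × ℤ × ℤ, (0 < ‖hcpSite a h q - hcpSite a h p‖ ∧ ‖hcpSite a h q - hcpSite a h p‖ ≤ 11 / 10 * a) ↔ q ∈ SH) :
    ∀ Z : Fin 3 → Fin 3 → ℝ, (∀ j k, Z j k = -Z k j) →
      ∑ q ∈ SH, ∑ k : Fin 3, (u q k - u p k - ((hcpSite a h q 0 - hcpSite a h p 0) * A 0 k + (hcpSite a h q 1 - hcpSite a h p 1) * A 1 k +
          (hcpSite a h q 2 - hcpSite a h p 2) * A 2 k)) * (∑ j : Fin 3, (hcpSite a h q j - hcpSite a h p j) * Z j k) = 0 := by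
  have hshell : ∀ f : ℤ × ℤ × ℤ → ℝ, (∑' q : ℤ × ℤ × ℤ,
      (if 0 < ‖hcpSite a h q - hcpSite a h p‖ ∧ ‖hcpSite a h q - hcpSite a h p‖ ≤ 11 / 10 * a then f q else 0)) = ∑ q ∈ SH, f q := by
    intro f
    rw [tsum_eq_sum (s := SH) fun q hq => if_neg fun hc => hq ((hSH q).1 hc)]
    exact Finset.sum_congr rfl fun q hq => if_pos ((hSH q).2 hq)
  intro Z hZ
  obtain ⟨Z', hZ'⟩ := exists_linearMap_of_matrix Z
  have hZ'skew := inner_apply_self_eq_zero_of_antisymm hZ hZ'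
  -- the quadratic in t
  set Mz : ℝ := ∑ q ∈ SH, ∑ k : Fin 3, (u q k - u p k - ((hcpSite a h q 0 - hcpSite a h p 0) * A 0 k + (hcpSite a h q 1 - hcpSite a h p 1) * A 1 k +
        (hcpSite a h q 2 - hcpSite a h p 2) * A 2 k)) * (∑ j : Fin 3, (hcpSite a h q j - hcpSite a h p j) * Z j k) with hMz
  set Bz : ℝ := ∑ q ∈ SH, ‖Z' (hcpSite a h q - hcpSite a h p)‖ ^ 2 with hBz
  have hBz0 : 0 ≤ Bz := Finset.sum_nonneg fun q _ => by positivity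
  have hquad : ∀ t : ℝ, 0 ≤ -(2 * t * Mz) + t ^ 2 * Bz := by
    intro t
    have hW't : ∀ z : EuclideanSpace ℝ (Fin 3), inner ℝ ((W + t • Z') z) z = 0 := by
      intro z
      rw [LinearMap.add_apply, LinearMap.smul_apply, inner_add_left, real_inner_smul_left, hWskew, hZ'skew]
      ring
    have h1 := hWLS (W + t • Z') hW't
    rw [hshell, hshell] at h1
    -- expand each term of the right-hand side
    have hexp : ∀ q, ‖u q - u p - (W + t • Z') (hcpSite a h q - hcpSite a h p)‖ ^ 2 =
        ‖u q - u p - W (hcpSite a h q - hcpSite a h p)‖ ^ 2 -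
          2 * t * (∑ k : Fin 3, (u q k - u p k - ((hcpSite a h q 0 - hcpSite a h p 0) * A 0 k + (hcpSite a h q 1 - hcpSite a h p 1) * A 1 k +
            (hcpSite a h q 2 - hcpSite a h p 2) * A 2 k)) * (∑ j : Fin 3, (hcpSite a h q j - hcpSite a h p j) * Z j k)) +
          t ^ 2 * ‖Z' (hcpSite a h q - hcpSite a h p)‖ ^ 2 := by
      intro q
      have e1 : u q - u p - (W + t • Z') (hcpSite a h q - hcpSite a h p) =
          (u q - u p - W (hcpSite a h q - hcpSite a h p)) - t • Z' (hcpSite a h q - hcpSite a h p) := by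
        rw [LinearMap.add_apply, LinearMap.smul_apply]; abel
      rw [e1, @norm_sub_sq_real, real_inner_smul_right, norm_smul, mul_pow, Real.norm_eq_abs, sq_abs]
      have e2 : inner ℝ (u q - u p - W (hcpSite a h q - hcpSite a h p)) (Z' (hcpSite a h q - hcpSite a h p)) =
          ∑ k : Fin 3, (u q k - u p k - ((hcpSite a h q 0 - hcpSite a h p 0) * A 0 k + (hcpSite a h q 1 - hcpSite a h p 1) * A 1 k +
            (hcpSite a h q 2 - hcpSite a h p 2) * A 2 k)) * (∑ j : Fin 3, (hcpSite a h q j - hcpSite a h p j) * Z j k) := by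
        rw [inner_fin3, Fin.sum_univ_three, hZ', hZ', hZ']
        simp only [Fin.sum_univ_three, PiLp.sub_apply, hA]
      rw [e2]
      ring
    simp only [hexp] at h1
    rw [Finset.sum_add_distrib, Finset.sum_sub_distrib, ← Finset.mul_sum, ← Finset.mul_sum] at h1
    linarith
  -- a quadratic `t²B − 2tM ≥ 0` for all `t` forces `M = 0`
  by_contra hne
  have h2 := hquad (Mz / (Bz + 1))
  have hB1 : 0 < Bz + 1 := by linarith
  have h3 : 0 ≤ -(2 * (Mz / (Bz + 1)) * Mz) + (Mz / (Bz + 1)) ^ 2 * Bz := h2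
  have h4 : -(2 * (Mz / (Bz + 1)) * Mz) + (Mz / (Bz + 1)) ^ 2 * Bz = Mz ^ 2 * (Bz - 2 * (Bz + 1)) / (Bz + 1) ^ 2 := by
    field_simp
    ring
  rw [h4] at h3
  have h5 : 0 < Mz ^ 2 := by positivity
  have h6 : Mz ^ 2 * (Bz - 2 * (Bz + 1)) / (Bz + 1) ^ 2 < 0 := by
    apply div_neg_of_neg_of_pos _ (by positivity)
    nlinarith
  linarith

/-! ## The readout legs -/

/-- **THE READOUT-FORM SERIES MINUS THE FAR SHARES IS AT MOST THE FINITE NEAR READOUT TERM.**  For `β` with the decay of `CoreJointCoercive`, `u` finitely supported,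
`W` acting by `A`, far shares `w ≥ 0` with summable geometric loads and routed vertical shares `wv ≥ 0` summable along `sv`, a finite leg set `LEG` off which the far
shares take at least the full load, and the column sums `colβ`: with `V = p1DispSite a h u b₀ A` (any `b₀`),
`Σ'_q[q≠p]Σ_{s∈Y₁}(β(b_q)(p−q)(s)·½R(q,s) − β(b_p)(q−p)(s)·½R(p,s)) − (Σ'_e w_e R_e + Σ'_q wv_q R(q,sv)) ≤ p1NearRead p Y₁ β w sv wv colβ LEG V`.
NOT a proof of H12⋆, NOT summit progress. -/
theorem readoutForm_sub_farShares_le_p1NearRead {a h : ℝ} (ha : 0 < a) (hh : 0 < h)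
    (Y₁ : Finset (ℤ × ℤ × ℤ)) (β : Bool → (ℤ × ℤ × ℤ) → (ℤ × ℤ × ℤ) → ℝ)
    {Cβ : ℝ} (hβ : ∀ p q : ℤ × ℤ × ℤ, ∀ s, |β (decide (Even p.1)) (q - p) s| ≤ Cβ * ((1 + ‖hcpSite a h q - hcpSite a h p‖)⁻¹) ^ 6)
    (u : ℤ × ℤ × ℤ → EuclideanSpace ℝ (Fin 3)) (hu : (support u).Finite) (p : ℤ × ℤ × ℤ)
    (W : EuclideanSpace ℝ (Fin 3) →ₗ[ℝ] EuclideanSpace ℝ (Fin 3))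
    (A : Fin 3 → Fin 3 → ℝ) (hA : ∀ (y : EuclideanSpace ℝ (Fin 3)) (k : Fin 3), W y k = y 0 * A 0 k + y 1 * A 1 k + y 2 * A 2 k)
    (b₀ : Fin 3 → ℝ)
    (w : (ℤ × ℤ × ℤ) × (ℤ × ℤ × ℤ) → ℝ) (hw : ∀ e, 0 ≤ w e)
    (hws : Summable fun e : (ℤ × ℤ × ℤ) × (ℤ × ℤ × ℤ) => w e * fpSq (fun k => hcpSite a h (e.1 + e.2) k - hcpSite a h e.1 k))
    (sv : ℤ × ℤ × ℤ) (wv : ℤ × ℤ × ℤ → ℝ) (hwv : ∀ q, 0 ≤ wv q) (hwvs : Summable wv)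
    (LEG : Finset ((ℤ × ℤ × ℤ) × (ℤ × ℤ × ℤ)))
    (hwfar : ∀ e : (ℤ × ℤ × ℤ) × (ℤ × ℤ × ℤ), e ∉ LEG →
      (if e.1 ≠ p ∧ e.2 ∈ Y₁ then 1 / 2 * β (decide (Even e.1.1)) (p - e.1) e.2 else 0) ≤ w e + (if e.2 = sv then wv e.1 else 0))
    (colβ : (ℤ × ℤ × ℤ) → ℝ)
    (hcol : ∀ s ∈ Y₁, HasSum (fun q : ℤ × ℤ × ℤ => if q = p then (0 : ℝ) else β (decide (Even p.1)) (q - p) s) (colβ s)) :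
    (∑' q : ℤ × ℤ × ℤ, (if q = p then (0 : ℝ) else
      ∑ s ∈ Y₁,
        (β (decide (Even q.1)) (p - q) s *
            (1 / 2 * ‖u (q + s) - u q - W (hcpSite a h (q + s) - hcpSite a h q)‖ ^ 2) -
          β (decide (Even p.1)) (q - p) s *
            (1 / 2 * ‖u (p + s) - u p - W (hcpSite a h (p + s) - hcpSite a h p)‖ ^ 2)))) -
    ((∑' e : (ℤ × ℤ × ℤ) × (ℤ × ℤ × ℤ), w e * ‖u (e.1 + e.2) - u e.1 - W (hcpSite a h (e.1 + e.2) - hcpSite a h e.1)‖ ^ 2) +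
      (∑' q : ℤ × ℤ × ℤ, wv q * ‖u (q + sv) - u q - W (hcpSite a h (q + sv) - hcpSite a h q)‖ ^ 2)) ≤
    p1NearRead p Y₁ β w sv wv colβ LEG (fun n k => p1DispSite a h (fun n k => u n k) b₀ A n k) := by
  have ha' := ha.ne'
  have hh' := hh.ne'
  have hU : (support fun n => fun k => u n k).Finite := by
    refine hu.subset fun n hn => ?_
    simp only [mem_support, ne_eq] at hn ⊢
    intro h0
    apply hn
    funext k
    rw [h0]
    rfl
  set V : ℤ × ℤ × ℤ → (Fin 3 → ℝ) := fun n k => p1DispSite a h (fun n k => u n k) b₀ A n k with hVdef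
  have hR : ∀ q s, ‖u (q + s) - u q - W (hcpSite a h (q + s) - hcpSite a h q)‖ ^ 2 = p1NRead V q s := fun q s =>
    norm_sq_coreReadout_eq_fpSq ha' hh' u W A hA b₀ q s
  simp only [hR]
  -- the two halves of the readout-form series
  set A1 : (ℤ × ℤ × ℤ) → ℝ := fun q => if q = p then (0 : ℝ) else ∑ s ∈ Y₁, β (decide (Even q.1)) (p - q) s * (1 / 2 * p1NRead V q s) with hA1
  set A2 : (ℤ × ℤ × ℤ) → ℝ := fun q => if q = p then (0 : ℝ) else ∑ s ∈ Y₁, β (decide (Even p.1)) (q - p) s * (1 / 2 * p1NRead V p s) with hA2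
  have hleg := coreJoint_readoutForm_le_tsum_legLoad ha hh Y₁ β hβ u hu p W A hA
  obtain ⟨hA1s, hAbs, -⟩ := hleg
  simp only [hR] at hA1s
  have hnormV0 : ∀ q s, fpSq (fun k => p1DispSite a h (fun n k => u n k) 0 A (q + s) k - p1DispSite a h (fun n k => u n k) 0 A q k) = p1NRead V q s := by
    intro q s
    rw [← norm_sq_coreReadout_eq_fpSq ha' hh' u W A hA 0 q s, hR]
  simp only [hnormV0] at hAbs
  have hA2s : Summable A2 := by
    refine summableTransfer_guard p (summable_sum fun s hs => ?_)
    have h1 := (hcol s hs).summable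
    have h2 : Summable fun q : ℤ × ℤ × ℤ => (if q = p then (0 : ℝ) else β (decide (Even p.1)) (q - p) s) * (1 / 2 * p1NRead V p s) := h1.mul_right _
    refine (summableTransfer_summable_of_abs_le ha hh p (C := Cβ * (1 / 2 * p1NRead V p s))
      (F := fun q => β (decide (Even p.1)) (q - p) s * (1 / 2 * p1NRead V p s)) fun q => ?_)
    rw [abs_mul, abs_of_nonneg (by have := p1NRead_nonneg V p s; positivity : (0 : ℝ) ≤ 1 / 2 * p1NRead V p s)]
    calc |β (decide (Even p.1)) (q - p) s| * (1 / 2 * p1NRead V p s) ≤ Cβ * ((1 + ‖hcpSite a h q - hcpSite a h p‖)⁻¹) ^ 6 * (1 / 2 * p1NRead V p s) :=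
          mul_le_mul_of_nonneg_right (hβ p q s) (by have := p1NRead_nonneg V p s; positivity)
      _ = _ := by ring
  have hRF : (∑' q : ℤ × ℤ × ℤ, (if q = p then (0 : ℝ) else
      ∑ s ∈ Y₁, (β (decide (Even q.1)) (p - q) s * (1 / 2 * p1NRead V q s) - β (decide (Even p.1)) (q - p) s * (1 / 2 * p1NRead V p s)))) =
      (∑' q, A1 q) - ∑' q, A2 q := by
    rw [← hA1s.tsum_sub hA2s]
    refine tsum_congr fun q => ?_
    by_cases hq : q = p
    · simp [hA2, hq]
    · simp only [hA2, if_neg hq, ← Finset.sum_sub_distrib]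
  -- Σ' A2 = Σ_{s∈Y₁} ½ colβ_s R(p,s)
  have hA2sum : ∑' q, A2 q = ∑ s ∈ Y₁, 1 / 2 * colβ s * p1NRead V p s := by
    have e1 : ∀ q, A2 q = ∑ s ∈ Y₁, (if q = p then (0 : ℝ) else β (decide (Even p.1)) (q - p) s) * (1 / 2 * p1NRead V p s) := by
      intro q
      simp only [hA2]
      split_ifs
      · simp
      · rfl
    rw [tsum_congr e1, Summable.tsum_finsetSum (fun s hs => (hcol s hs).summable.mul_right _)]
    refine Finset.sum_congr rfl fun s hs => ?_
    rw [tsum_mul_right, (hcol s hs).tsum_eq]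
    ring
  -- Σ' A1 as a series over legs
  set Φ : (ℤ × ℤ × ℤ) × (ℤ × ℤ × ℤ) → ℝ := fun e =>
    (if e.1 ≠ p ∧ e.2 ∈ Y₁ then 1 / 2 * β (decide (Even e.1.1)) (p - e.1) e.2 else 0) * p1NRead V e.1 e.2 with hΦ
  have hΦs : Summable Φ := by
    refine Summable.of_norm_bounded hAbs fun e => ?_
    rw [Real.norm_eq_abs, hΦ]
    dsimp only
    rw [abs_mul, abs_of_nonneg (p1NRead_nonneg V e.1 e.2)]
    refine mul_le_mul_of_nonneg_right ?_ (p1NRead_nonneg V e.1 e.2)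
    by_cases h1 : e.1 ≠ p ∧ e.2 ∈ Y₁
    · rw [if_pos h1, if_pos h1.2, abs_mul, abs_of_nonneg (by norm_num : (0 : ℝ) ≤ 1 / 2)]
      linarith [abs_nonneg (β (decide (Even e.1.1)) (p - e.1) e.2)]
    · rw [if_neg h1, abs_zero]
      split_ifs <;> positivity
  have hA1sum : ∑' q, A1 q = ∑' e, Φ e := by
    rw [hΦs.tsum_prod]
    refine tsum_congr fun q => ?_
    simp only [hA1, hΦ]
    by_cases hq : q = p
    · rw [if_pos hq]
      simp [hq]
    · rw [if_neg hq, tsum_eq_sum (s := Y₁) fun s hs => by rw [if_neg (fun h => hs h.2), zero_mul]]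
      refine Finset.sum_congr rfl fun s hs => ?_
      rw [if_pos ⟨hq, hs⟩]
      ring
  -- the two far-share series as series over legs
  have hwR : Summable fun e : (ℤ × ℤ × ℤ) × (ℤ × ℤ × ℤ) => w e * p1NRead V e.1 e.2 := by
    have := summable_legLoad_p1DispSite ha hh _ hU b₀ A w hw hws
    exact this
  obtain ⟨Bv, hBv⟩ := exists_bound_readout_p1DispSite ha hh _ hU b₀ A sv
  set Φv : (ℤ × ℤ × ℤ) × (ℤ × ℤ × ℤ) → ℝ := fun e => (if e.2 = sv then wv e.1 else 0) * p1NRead V e.1 e.2 with hΦv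
  have hΦv0 : ∀ e, 0 ≤ Φv e := fun e => mul_nonneg (by split_ifs; exacts [hwv _, le_rfl]) (p1NRead_nonneg V e.1 e.2)
  have hΦvrow : ∀ q : ℤ × ℤ × ℤ, ∑' s, Φv (q, s) = wv q * p1NRead V q sv := by
    intro q
    rw [tsum_eq_single sv fun s hs => by simp only [hΦv, if_neg hs, zero_mul]]
    simp only [hΦv, if_true]
  have hΦvs : Summable Φv := by
    refine (summable_prod_of_nonneg hΦv0).2 ⟨fun q => summable_of_ne_finset_zero (s := {sv}) fun s hs => ?_, ?_⟩
    · rw [Finset.mem_singleton] at hs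
      simp only [hΦv, if_neg hs, zero_mul]
    · refine (Summable.of_nonneg_of_le (fun q => mul_nonneg (hwv q) (p1NRead_nonneg V q sv)) (fun q => ?_) (hwvs.mul_right Bv)).congr
        fun q => (hΦvrow q).symm
      exact mul_le_mul_of_nonneg_left (hBv q) (hwv q)
  have hFRv : ∑' q : ℤ × ℤ × ℤ, wv q * p1NRead V q sv = ∑' e, Φv e := by
    rw [hΦvs.tsum_prod]
    exact tsum_congr fun q => (hΦvrow q).symm
  -- the combined leg family
  set Ψ : (ℤ × ℤ × ℤ) × (ℤ × ℤ × ℤ) → ℝ := fun e =>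
    ((if e.1 ≠ p ∧ e.2 ∈ Y₁ then 1 / 2 * β (decide (Even e.1.1)) (p - e.1) e.2 else 0) - w e -
      (if e.2 = sv then wv e.1 else 0)) * p1NRead V e.1 e.2 with hΨ
  have hΨeq : ∀ e, Ψ e = Φ e - w e * p1NRead V e.1 e.2 - Φv e := fun e => by simp only [hΨ, hΦ, hΦv]; ring
  have hΨs : Summable Ψ := ((hΦs.sub hwR).sub hΦvs).congr fun e => (hΨeq e).symm
  have hΨsum : ∑' e, Ψ e = (∑' e, Φ e) - (∑' e : (ℤ × ℤ × ℤ) × (ℤ × ℤ × ℤ), w e * p1NRead V e.1 e.2) - ∑' e, Φv e := by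
    rw [← hΦs.tsum_sub hwR, ← (hΦs.sub hwR).tsum_sub hΦvs]
    exact tsum_congr hΨeq
  -- split over LEG and drop the complement by sign
  have hΨle : ∑' e, Ψ e ≤ ∑ e ∈ LEG, Ψ e := by
    rw [← hΨs.sum_add_tsum_compl (s := LEG), add_le_iff_nonpos_right]
    refine tsum_nonpos fun e => ?_
    have he : (e : (ℤ × ℤ × ℤ) × (ℤ × ℤ × ℤ)) ∉ LEG := by
      have h2 := e.2
      rw [Set.mem_compl_iff, Finset.mem_coe] at h2
      exact h2
    have h1 := hwfar e.1 he
    simp only [hΨ]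
    exact mul_nonpos_of_nonpos_of_nonneg (by linarith) (p1NRead_nonneg V _ _)
  -- assemble
  rw [hRF, hA1sum, hA2sum, hFRv, p1NearRead]
  have hLEG : ∑ e ∈ LEG, Ψ e = ∑ e ∈ LEG, ((if e.1 ≠ p ∧ e.2 ∈ Y₁ then 1 / 2 * β (decide (Even e.1.1)) (p - e.1) e.2 else 0) - w e -
      (if e.2 = sv then wv e.1 else 0)) * p1NRead V e.1 e.2 := rfl
  linarith [hΨle, hΨsum, hLEG]
end Summit.AtomisticToContinuum.Crystallization.Theorems.StrictSplittingRuleBirth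

end
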